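import Literature.IUT.LogVolume.ExplicitEstimatesFermatLemmas
import HarnessLib

/-!
# [ExpEst] §5, Lemma 5.7 (elementary estimate for possible solutions of the Fermat equation: `z > (p+1)^p/2`) — PROVED

S. Mochizuki, I. Fesenko, Y. Hoshi, A. Minamide, W. Porowski, *Explicit estimates in inter-universal
Teichmüller theory*, Kodai Math. J. **45** (2022) 175–236 (= [ExpEst]), §5, **Lemma 5.7** (p. 227) with its
proof (pp. 227–229, Claims 5.7A, 5.7B, 5.7C; render
`plan/repair/lit/renders/MFHMP-ExplicitEstimates-Kodai2022-book-anonnd-eeiutp`, pdf p. 53 l.5 – p. 55 l.36;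
pdf page = journal page − 174). CLASSICAL, UNDISPUTED, PROVED; companion of `ExplicitEstimatesFermatLemmas.lean`
(Lemmas 5.5–5.6) and input of `ExplicitEstimatesFLTLargePrimes.lean` (Cor. 5.8 from the disputed Theorem B).
The key `MochizukiEtAl2022` carries the D-0012 claim status, hence the tag form; nothing here depends on
[IUTchIII] Cor. 3.12. No definition, no named fact.

**Lemma 5.7 as printed (p. 227).** "Let `p ≥ 3` be a prime number; `x, y, z` coprime positive integers such that
`x^p + y^p = z^p`. Then it holds that `z > (p + 1)^p / 2`."

*Typed* as `ExpEst.lemma57 : (p + 1)^p < 2z` over `ℕ` ("coprime" rendered `Nat.Coprime x y`, equivalent for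
a Fermat triple to the coprimality of all three). *Proof* as printed: `z ≡ x + y (mod p)` (Fermat); Lemma 5.6 (ii)
applied to `(x, y, −z)`, `(z, −x, −y)`, `(z, −y, −x)` (`extract_xy`, `extract_zx`); case `p ∣ x` (or `p ∣ y`):
Claim 5.7A `max{a, b} ≥ p + 1` (else `z = 2x + y`), so `2z > z + y = a^p + b^p` (`lemma57_case_dvd_x`); case
`p ∤ xyz`: Claim 5.7B `a ≥ p + 1` — else `a = b + c` and the parity argument of Claim 5.7C (`(b^p + c^p)/(b + c) =
2ã − a^{p−1}` resp. `(a^p − c^p)/(a − c) = 2b̃ − b^{p−1}` even vs. a sum of `p` odd terms; `parity_core` applied to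
`(x, y)` and `(y, x)`) excludes every parity pattern — so `2z > x + y = a^p` (`lemma57_case_ndvd`); case `p ∣ z`:
print's `x + y = p^{κp−1} w^p`, `κ ≥ 2` via Lemma 5.6 (iii) is obtained in the kernel from Mathlib's
lifting-the-exponent lemma `padicValNat.pow_add_pow` (`v_p(x + y) + 1 = p·v_p(z)`), `v_p(z) ≥ 2` exactly as
printed (`p² ∣ b^p + c^p`, `2z = b^p + c^p + (x + y)`), then `2z > x + y ≥ p^{2p−1} > (p+1)^p`
(`lemma57_case_dvd_z`) — a deviation of ROUTE, not of statement. The printed decomposition itself — Lemma 5.6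
(iii) "in particular": `x + y = p^{κp−1} w^p`, `(x^p + y^p)/(x + y) = p w̃^p`, `v = −w w̃` with `p ∤ w, w̃` for
`−z = p^κ v` — is PROVED at the end of this file (`lemma56_iii_particular`, appended), completing Lemma 5.6 as
printed.

## References
* [MochizukiEtAl2022] Kodai Math. J. 45 (2022), Lemma 5.7 (pp. 227–229) [claim key, D-0012; the lemma is
  classical — cf. its Rmk. 5.7.1 citing Inkeri 1953].
-/

namespace Literature.IUT.LogVolume

namespace ExpEst

open Finset

section Lemma57

variable {p : ℕ}

/-- Odd primes `≥ 3`. [folklore] -/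
private theorem odd_of_three_le (hp : p.Prime) (hp3 : 3 ≤ p) : Odd p :=
  hp.odd_of_ne_two (by omega)

/-- `z ≡ x + y (mod p)` for a Fermat triple of exponent `p` (Fermat's little theorem in `ZMod p`).
[cite: MochizukiEtAl2022, Lemma 5.7 proof p. 227] -/
private theorem zmod_z_eq (hp : p.Prime) {x y z : ℕ} (heq : x ^ p + y ^ p = z ^ p) :
    ((z : ℕ) : ZMod p) = x + y := by
  haveI : Fact p.Prime := ⟨hp⟩
  have h := congrArg (Nat.cast : ℕ → ZMod p) heq
  push_cast at h
  rw [ZMod.pow_card, ZMod.pow_card, ZMod.pow_card] at h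
  exact h.symm

/-- `z < 2x + y` for a Fermat triple with `x > 0` ("`(2x + y)^p > x^p + y^p`", p. 228). [cite: MochizukiEtAl2022, Lemma 5.7 proof p. 228] -/
private theorem lt_two_mul_add (hp0 : p ≠ 0) {x y z : ℕ} (hx : 0 < x) (heq : x ^ p + y ^ p = z ^ p) :
    z < 2 * x + y := by
  by_contra h
  push Not at h
  have h1 : (2 * x + y) ^ p ≤ z ^ p := Nat.pow_le_pow_left h p
  have h2 : (2 * x) ^ p + y ^ p ≤ (2 * x + y) ^ p := pow_add_pow_le (by positivity) (by positivity) hp0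
  have h3 : x ^ p < (2 * x) ^ p := Nat.pow_lt_pow_left (by omega) hp0
  omega

/-- `x < z` for a Fermat triple with `y > 0`. [folklore] -/
private theorem lt_of_fermat {x y z : ℕ} (hy : 0 < y) (heq : x ^ p + y ^ p = z ^ p) : x < z := by
  have : 0 < y ^ p := pow_pos hy p
  exact lt_of_pow_lt_pow_left₀ p (Nat.zero_le z) (by omega)

/-- `x, z` are coprime for a Fermat triple with `x, y` coprime. [folklore] -/
private theorem coprime_z (hp : p.Prime) {x y z : ℕ} (hxy : Nat.Coprime x y) (heq : x ^ p + y ^ p = z ^ p) :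
    Nat.Coprime x z := by
  refine Nat.coprime_of_dvd fun l hl hlx hlz => ?_
  have hly : l ∣ y := by
    refine hl.dvd_of_dvd_pow (n := p) ?_
    have : y ^ p = z ^ p - x ^ p := by omega
    rw [this]
    exact Nat.dvd_sub (dvd_pow hlz hp.ne_zero) (dvd_pow hlx hp.ne_zero)
  have := Nat.dvd_gcd hlx hly
  rw [hxy] at this
  exact hl.ne_one (Nat.dvd_one.mp this)

/-- Lemma 5.6 (ii) for `(r, s, t) = (x, y, −z)`: `x + y = a^p`, `(x^p + y^p)/(x + y) = ã^p`, `z = aã`, with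
`a, ã > 0`. [cite: MochizukiEtAl2022, Lemma 5.7 proof p. 227] -/
private theorem extract_xy (hp : p.Prime) (hodd : Odd p) {x y z : ℕ} (hx : 0 < x) (hz : 0 < z)
    (hxy : Nat.Coprime x y) (heq : x ^ p + y ^ p = z ^ p) (hpz : ¬ p ∣ z) :
    ∃ a a' : ℤ, (x : ℤ) + y = a ^ p ∧ powSumQuot p x y = a' ^ p ∧ (z : ℤ) = a * a' ∧ 0 < a ∧ 0 < a' := by
  have hcast : ((x ^ p + y ^ p : ℕ) : ℤ) = (z ^ p : ℕ) := by exact_mod_cast heq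
  push_cast at hcast
  have heq' : (x : ℤ) ^ p + (y : ℤ) ^ p + (-(z : ℤ)) ^ p = 0 := by rw [hodd.neg_pow]; linarith
  have hpt : ¬ (p : ℤ) ∣ -(z : ℤ) := by
    rw [dvd_neg]; exact_mod_cast hpz
  obtain ⟨-, u, v, hu, hv, ht⟩ := lemma56_ii hp hodd (Nat.isCoprime_iff_coprime.mpr hxy) heq' hpt
  have hzuv : (z : ℤ) = u * v := by linarith
  have hu0 : 0 < u := by
    have : (0 : ℤ) < u ^ p := by rw [← hu]; exact_mod_cast (by omega : 0 < x + y)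
    exact hodd.pow_pos_iff.mp this
  have hv0 : 0 < v := pos_of_mul_pos_right (by rw [← hzuv]; exact_mod_cast hz) hu0.le
  exact ⟨u, v, hu, hv, hzuv, hu0, hv0⟩

/-- Lemma 5.6 (ii) for `(r, s, t) = (z, −x, −y)`: `z − x = b^p`, `(z^p − x^p)/(z − x) = b̃^p`, `y = bb̃`, with
`b, b̃ > 0`. [cite: MochizukiEtAl2022, Lemma 5.7 proof p. 227] -/
private theorem extract_zx (hp : p.Prime) (hodd : Odd p) {x y z : ℕ} (hy : 0 < y) (hxz : Nat.Coprime x z)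
    (hlt : x < z) (heq : x ^ p + y ^ p = z ^ p) (hpy : ¬ p ∣ y) :
    ∃ b b' : ℤ, (z : ℤ) - x = b ^ p ∧ powSumQuot p z (-(x : ℤ)) = b' ^ p ∧ (y : ℤ) = b * b' ∧
      0 < b ∧ 0 < b' := by
  have hcast : ((x ^ p + y ^ p : ℕ) : ℤ) = (z ^ p : ℕ) := by exact_mod_cast heq
  push_cast at hcast
  have heq' : (z : ℤ) ^ p + (-(x : ℤ)) ^ p + (-(y : ℤ)) ^ p = 0 := by
    rw [hodd.neg_pow, hodd.neg_pow]; linarith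
  have hpt : ¬ (p : ℤ) ∣ -(y : ℤ) := by
    rw [dvd_neg]; exact_mod_cast hpy
  have hcop : IsCoprime (z : ℤ) (-(x : ℤ)) := (Nat.isCoprime_iff_coprime.mpr hxz.symm).neg_right
  obtain ⟨-, u, v, hu, hv, ht⟩ := lemma56_ii hp hodd hcop heq' hpt
  have hyuv : (y : ℤ) = u * v := by linarith
  have hu' : (z : ℤ) - x = u ^ p := by rw [← hu]; ring
  have hu0 : 0 < u := by
    have : (x : ℤ) < z := by exact_mod_cast hlt
    exact hodd.pow_pos_iff.mp (by rw [← hu']; linarith)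
  have hv0 : 0 < v := pos_of_mul_pos_right (by rw [← hyuv]; exact_mod_cast hy) hu0.le
  exact ⟨u, v, hu', hv, hyuv, hu0, hv0⟩

/-- `a` even together with `b` even is impossible (then `x, y` would both be even) — part of Claim 5.7C.
[cite: MochizukiEtAl2022, Lemma 5.7 proof p. 228] -/
private theorem not_even_even (hp0 : p ≠ 0) {X Y Z a a' b : ℤ} (hXY : IsCoprime X Y)
    (ha : X + Y = a ^ p) (hZ : Z = a * a') (hb : Z - X = b ^ p) (hae : Even a) (hbe : Even b) : False := by
  have hZ2 : (2 : ℤ) ∣ Z := by rw [hZ]; exact (even_iff_two_dvd.mp hae).mul_right _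
  have hX2 : (2 : ℤ) ∣ X := by
    have e : X = Z - b ^ p := by linarith
    rw [e]; exact dvd_sub hZ2 (dvd_pow (even_iff_two_dvd.mp hbe) hp0)
  have hY2 : (2 : ℤ) ∣ Y := by
    have e : Y = a ^ p - X := by linarith
    rw [e]; exact dvd_sub (dvd_pow (even_iff_two_dvd.mp hae) hp0) hX2
  exact Int.prime_two.not_unit (hXY.isUnit_of_dvd' hX2 hY2)

/-- The parity core of Claims 5.7B/5.7C (p. 228–229): in the configuration `x + y = a^p`, `z = aã`,
`z − x = b^p`, `y = bb̃`, `z − y = c^p`, `a = b + c`, neither `a` nor `b` is even.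
[cite: MochizukiEtAl2022, Lemma 5.7 proof p. 228–229] -/
private theorem parity_core (hodd : Odd p) (hp2 : 2 ≤ p) {X Y Z a a' b b' c : ℤ} (hXY : IsCoprime X Y)
    (ha : X + Y = a ^ p) (hZ : Z = a * a') (hb : Z - X = b ^ p) (hY : Y = b * b') (hc : Z - Y = c ^ p)
    (habc : a = b + c) (ha0 : a ≠ 0) (hb0 : b ≠ 0) : ¬ Even a ∧ ¬ Even b := by
  have hp0 : p ≠ 0 := hodd.pos.ne'
  have hpow : ∀ w : ℤ, w ^ p = w ^ (p - 1) * w := fun w => (pow_sub_one_mul hp0 w).symm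
  constructor
  · intro hae
    have hbo : Odd b := by
      by_contra hbe
      exact not_even_even hp0 hXY ha hZ hb hae (Int.not_odd_iff_even.mp hbe)
    have hco : Odd c := by
      have e : c = a - b := by linarith
      rw [e]; exact hae.sub_odd hbo
    -- `(b^p + c^p)/(b + c) = 2ã − a^{p−1}` is even, but it is a sum of `p` odd terms
    have hQodd : Odd (powSumQuot p b c) := odd_geom_sum₂ hodd hbo hco.neg
    have hQeq : powSumQuot p b c * a = (2 * a' - a ^ (p - 1)) * a := by
      calc powSumQuot p b c * a = powSumQuot p b c * (b + c) := by rw [habc]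
        _ = b ^ p + c ^ p := powSumQuot_mul_add hodd b c
        _ = 2 * Z - a ^ p := by linarith
        _ = (2 * a' - a ^ (p - 1)) * a := by rw [hZ, hpow a]; ring
    have hQ : powSumQuot p b c = 2 * a' - a ^ (p - 1) := mul_right_cancel₀ ha0 hQeq
    have hQeven : Even (powSumQuot p b c) := by
      rw [hQ]; exact (even_two_mul _).sub (hae.pow_of_ne_zero (by omega))
    exact (Int.not_even_iff_odd.mpr hQodd) hQeven
  · intro hbe
    have hao : Odd a := by
      by_contra hae
      exact not_even_even hp0 hXY ha hZ hb (Int.not_odd_iff_even.mp hae) hbe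
    have hco : Odd c := by
      have e : c = a - b := by linarith
      rw [e]; exact hao.sub_even hbe
    -- `(a^p − c^p)/(a − c) = 2b̃ − b^{p−1}` is even, but it is a sum of `p` odd terms
    have hSodd : Odd (∑ i ∈ Finset.range p, a ^ i * c ^ (p - 1 - i)) := odd_geom_sum₂ hodd hao hco
    have hSeq : (∑ i ∈ Finset.range p, a ^ i * c ^ (p - 1 - i)) * b = (2 * b' - b ^ (p - 1)) * b := by
      calc (∑ i ∈ Finset.range p, a ^ i * c ^ (p - 1 - i)) * b
          = (∑ i ∈ Finset.range p, a ^ i * c ^ (p - 1 - i)) * (a - c) := by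
            rw [show a - c = b by linarith]
        _ = a ^ p - c ^ p := geom_sum₂_mul a c p
        _ = 2 * Y - (Z - X) := by linarith
        _ = (2 * b' - b ^ (p - 1)) * b := by rw [hY, hb, hpow b]; ring
    have hS : (∑ i ∈ Finset.range p, a ^ i * c ^ (p - 1 - i)) = 2 * b' - b ^ (p - 1) :=
      mul_right_cancel₀ hb0 hSeq
    have hSeven : Even (∑ i ∈ Finset.range p, a ^ i * c ^ (p - 1 - i)) := by
      rw [hS]; exact (even_two_mul _).sub (hbe.pow_of_ne_zero (by omega))
    exact (Int.not_even_iff_odd.mpr hSodd) hSeven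

/-- Lemma 5.7, case `p ∣ x` (Claim 5.7A, p. 227–228). [cite: MochizukiEtAl2022, Lemma 5.7 proof p. 227–228] -/
private theorem lemma57_case_dvd_x (hp : p.Prime) (hp3 : 3 ≤ p) {x y z : ℕ} (hx : 0 < x) (hy : 0 < y)
    (hxy : Nat.Coprime x y) (heq : x ^ p + y ^ p = z ^ p) (hpx : p ∣ x) : (p + 1) ^ p < 2 * z := by
  haveI : Fact p.Prime := ⟨hp⟩
  have hodd := odd_of_three_le hp hp3
  have hp0 : p ≠ 0 := hp.ne_zero
  have hxz := lt_of_fermat hy heq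
  have hyz : y < z := lt_of_fermat hx (by rw [add_comm]; exact heq)
  have hz : 0 < z := by omega
  have hxz_cop := coprime_z hp hxy heq
  have hpy : ¬ p ∣ y := fun h => by
    have := Nat.dvd_gcd hpx h; rw [hxy] at this; exact hp.ne_one (Nat.dvd_one.mp this)
  have hpz : ¬ p ∣ z := fun h => by
    have := Nat.dvd_gcd hpx h; rw [hxz_cop] at this; exact hp.ne_one (Nat.dvd_one.mp this)
  obtain ⟨a, a', ha, -, -, ha0, -⟩ := extract_xy hp hodd hx hz hxy heq hpz
  obtain ⟨b, b', hb, -, -, hb0, -⟩ := extract_zx hp hodd hy hxz_cop hxz heq hpy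
  -- `b ≡ a (mod p)`
  have hzm := zmod_z_eq hp heq
  have hx0 : ((x : ℕ) : ZMod p) = 0 := (ZMod.natCast_eq_zero_iff x p).mpr hpx
  have hab : ((a : ℤ) : ZMod p) = ((b : ℤ) : ZMod p) := by
    have h1 := congrArg (Int.cast : ℤ → ZMod p) ha
    have h2 := congrArg (Int.cast : ℤ → ZMod p) hb
    push_cast at h1 h2
    rw [ZMod.pow_card] at h1 h2
    rw [← h1, ← h2, hzm, hx0]; ring
  have hpab : (p : ℤ) ∣ b - a := (ZMod.intCast_eq_intCast_iff_dvd_sub a b p).mp hab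
  -- Claim 5.7A: `max(a, b) ≥ p + 1`
  have hclaim : (p : ℤ) + 1 ≤ max a b := by
    by_contra hlt
    push Not at hlt
    have hap : a ≤ p := by have := le_max_left a b; omega
    have hbp : b ≤ p := by have := le_max_right a b; omega
    have habs : |b - a| < p := by rw [abs_sub_lt_iff]; constructor <;> omega
    have h0 : b - a = 0 := Int.eq_zero_of_abs_lt_dvd hpab habs
    have heqz : (z : ℤ) = 2 * x + y := by
      have : a ^ p = b ^ p := by rw [show a = b by omega]
      linarith
    have hz' : z = 2 * x + y := by exact_mod_cast heqz
    have := lt_two_mul_add hp0 hx heq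
    omega
  -- `(p+1)^p ≤ max(a,b)^p ≤ a^p + b^p = z + y < 2z`
  have hm0 : 0 ≤ max a b := le_trans ha0.le (le_max_left _ _)
  have h1 : ((p : ℤ) + 1) ^ p ≤ (max a b) ^ p := pow_le_pow_left₀ (by positivity) hclaim p
  have h2 : (max a b) ^ p ≤ a ^ p + b ^ p := by
    have hap : 0 ≤ a ^ p := pow_nonneg ha0.le p
    have hbp : 0 ≤ b ^ p := pow_nonneg hb0.le p
    rcases le_total a b with h | h
    · rw [max_eq_right h]; linarith
    · rw [max_eq_left h]; linarith
  have h3 : a ^ p + b ^ p = (z : ℤ) + y := by linarith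
  have h4 : ((p : ℤ) + 1) ^ p < 2 * z := by
    have : (y : ℤ) < z := by exact_mod_cast hyz
    linarith
  exact_mod_cast h4

/-- Lemma 5.7, case `p ∣ z` (p. 229), via the lifting-the-exponent lemma: `v_p(x + y) = p·v_p(z) − 1 ≥ 2p − 1`.
[cite: MochizukiEtAl2022, Lemma 5.7 proof p. 229] -/
private theorem lemma57_case_dvd_z (hp : p.Prime) (hp3 : 3 ≤ p) {x y z : ℕ} (hx : 0 < x) (hy : 0 < y)
    (hxy : Nat.Coprime x y) (heq : x ^ p + y ^ p = z ^ p) (hpz : p ∣ z) : (p + 1) ^ p < 2 * z := by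
  haveI : Fact p.Prime := ⟨hp⟩
  have hodd := odd_of_three_le hp hp3
  have hp0 : p ≠ 0 := hp.ne_zero
  have hxz := lt_of_fermat hy heq
  have hyz : y < z := lt_of_fermat hx (by rw [add_comm]; exact heq)
  have hz : 0 < z := by omega
  have hxz_cop := coprime_z hp hxy heq
  have hyz_cop : Nat.Coprime y z := coprime_z hp hxy.symm (by rw [add_comm]; exact heq)
  have hpx : ¬ p ∣ x := fun h => by
    have := Nat.dvd_gcd h hpz; rw [hxz_cop] at this; exact hp.ne_one (Nat.dvd_one.mp this)
  have hpy : ¬ p ∣ y := fun h => by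
    have := Nat.dvd_gcd h hpz; rw [hyz_cop] at this; exact hp.ne_one (Nat.dvd_one.mp this)
  obtain ⟨b, -, hb, -, -, -, -⟩ := extract_zx hp hodd hy hxz_cop hxz heq hpy
  obtain ⟨c, -, hc, -, -, -, -⟩ := extract_zx hp hodd hx hyz_cop hyz (by rw [add_comm]; exact heq) hpx
  -- `p ∣ x + y`
  have hzm := zmod_z_eq hp heq
  have hz0 : ((z : ℕ) : ZMod p) = 0 := (ZMod.natCast_eq_zero_iff z p).mpr hpz
  have hpxy : p ∣ x + y := by
    rw [← ZMod.natCast_eq_zero_iff]; push_cast; rw [← hzm, hz0]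
  -- lifting the exponent: `v(x + y) + 1 = p · v(z)`
  have hlte := padicValNat.pow_add_pow hodd hpxy hpx hodd
  rw [heq, padicValNat.pow, padicValNat_self] at hlte
  set k := padicValNat p z with hk
  have hk1 : 1 ≤ k := one_le_padicValNat_of_dvd hz.ne' hpz
  -- `k ≥ 2`
  have hk2 : 2 ≤ k := by
    by_contra hk2
    have hk1' : k = 1 := by omega
    have hv : 2 ≤ padicValNat p (x + y) := by
      have : padicValNat p (x + y) + 1 = p := by rw [← hlte, hk1', mul_one]
      omega
    have hp2xy : p ^ 2 ∣ x + y := (padicValNat_dvd_iff_le (by omega)).mpr hv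
    -- `p ∣ b + c`, hence `p² ∣ b^p + c^p = 2z − (x + y)`
    have hbc : (p : ℤ) ∣ b + c := by
      rw [← ZMod.intCast_zmod_eq_zero_iff_dvd]
      have h1 := congrArg (Int.cast : ℤ → ZMod p) hb
      have h2 := congrArg (Int.cast : ℤ → ZMod p) hc
      push_cast at h1 h2 ⊢
      rw [ZMod.pow_card] at h1 h2
      rw [← h1, ← h2, hz0]
      have hxy0 : ((x : ℕ) : ZMod p) + y = 0 := by rw [← hzm, hz0]
      linear_combination (-1 : ZMod p) * hxy0
    have hQ : (p : ℤ) ∣ powSumQuot p b c := by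
      have hsub : (p : ℤ) ∣ b - (-c) := by simpa [sub_neg_eq_add] using hbc
      exact (dvd_geom_sum₂_iff_of_dvd_sub hsub).mpr (dvd_mul_right _ _)
    have hp2bc : (p : ℤ) ^ 2 ∣ b ^ p + c ^ p := by
      rw [← powSumQuot_mul_add hodd b c, sq]
      exact mul_dvd_mul hQ hbc
    have hp2xy' : (p : ℤ) ^ 2 ∣ (x : ℤ) + y := by exact_mod_cast hp2xy
    have hp2z : (p : ℤ) ^ 2 ∣ 2 * (z : ℤ) := by
      have e : 2 * (z : ℤ) = (b ^ p + c ^ p) + ((x : ℤ) + y) := by linarith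
      rw [e]; exact dvd_add hp2bc hp2xy'
    have hp2z' : p ^ 2 ∣ z * 2 := by
      have : ((p ^ 2 : ℕ) : ℤ) ∣ ((z * 2 : ℕ) : ℤ) := by push_cast; rw [mul_comm]; exact hp2z
      exact Int.natCast_dvd_natCast.mp this
    have hcop2 : Nat.Coprime (p ^ 2) 2 := by
      refine Nat.Coprime.pow_left 2 ((Nat.Prime.coprime_iff_not_dvd hp).mpr ?_)
      intro h; have := Nat.le_of_dvd (by norm_num) h; omega
    have hp2z'' : p ^ 2 ∣ z := hcop2.dvd_of_dvd_mul_right hp2z'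
    have := (padicValNat_dvd_iff_le hz.ne').mp hp2z''
    omega
  -- `p^{2p−1} ∣ x + y`, so `p^{2p−1} ≤ x + y < 2z`
  have hv : 2 * p - 1 ≤ padicValNat p (x + y) := by
    have : padicValNat p (x + y) + 1 = p * k := hlte.symm
    have : p * 2 ≤ p * k := Nat.mul_le_mul_left p hk2
    omega
  have hdvd : p ^ (2 * p - 1) ∣ x + y := (padicValNat_dvd_iff_le (by omega)).mpr hv
  have hle : p ^ (2 * p - 1) ≤ x + y := Nat.le_of_dvd (by omega) hdvd
  have := succ_pow_lt_pow hp3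
  omega

/-- Lemma 5.7, case `p ∤ xyz` (Claims 5.7B, 5.7C, p. 228–229). [cite: MochizukiEtAl2022, Lemma 5.7 proof p. 228–229] -/
private theorem lemma57_case_ndvd (hp : p.Prime) (hp3 : 3 ≤ p) {x y z : ℕ} (hx : 0 < x) (hy : 0 < y)
    (hxy : Nat.Coprime x y) (heq : x ^ p + y ^ p = z ^ p) (hpx : ¬ p ∣ x) (hpy : ¬ p ∣ y) (hpz : ¬ p ∣ z) :
    (p + 1) ^ p < 2 * z := by
  haveI : Fact p.Prime := ⟨hp⟩
  have hodd := odd_of_three_le hp hp3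
  have hp0 : p ≠ 0 := hp.ne_zero
  have hxz := lt_of_fermat hy heq
  have heq' : y ^ p + x ^ p = z ^ p := by rw [add_comm]; exact heq
  have hyz : y < z := lt_of_fermat hx heq'
  have hz : 0 < z := by omega
  have hxz_cop := coprime_z hp hxy heq
  have hyz_cop : Nat.Coprime y z := coprime_z hp hxy.symm heq'
  have hXY : IsCoprime (x : ℤ) (y : ℤ) := Nat.isCoprime_iff_coprime.mpr hxy
  obtain ⟨a, a', ha, -, hza, ha0, hat0⟩ := extract_xy hp hodd hx hz hxy heq hpz
  obtain ⟨b, b', hb, -, hyb, hb0, hbt0⟩ := extract_zx hp hodd hy hxz_cop hxz heq hpy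
  obtain ⟨c, c', hc, -, hxc, hc0, hct0⟩ := extract_zx hp hodd hx hyz_cop hyz heq' hpx
  -- Claim 5.7B: `a ≥ p + 1`
  have hclaim : (p : ℤ) + 1 ≤ a := by
    by_contra hlt
    push Not at hlt
    have hap : a ≤ p := by omega
    -- `a > b`, `a > c`
    have hab : b < a := by
      have h1 : (z : ℤ) < 2 * x + y := by exact_mod_cast lt_two_mul_add hp0 hx heq
      have : b ^ p < a ^ p := by linarith
      exact (hodd.strictMono_pow (R := ℤ)).lt_iff_lt.mp this
    have hac : c < a := by
      have h1 : (z : ℤ) < 2 * y + x := by exact_mod_cast lt_two_mul_add hp0 hy heq'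
      have : c ^ p < a ^ p := by linarith
      exact (hodd.strictMono_pow (R := ℤ)).lt_iff_lt.mp this
    -- `b + c − a ≡ 0 (mod p)`
    have hzm := zmod_z_eq hp heq
    have hdiv : (p : ℤ) ∣ b + c - a := by
      rw [← ZMod.intCast_zmod_eq_zero_iff_dvd]
      have h1 := congrArg (Int.cast : ℤ → ZMod p) ha
      have h2 := congrArg (Int.cast : ℤ → ZMod p) hb
      have h3 := congrArg (Int.cast : ℤ → ZMod p) hc
      push_cast at h1 h2 h3 ⊢
      rw [ZMod.pow_card] at h1 h2 h3
      rw [← h1, ← h2, ← h3, hzm]; ring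
    have habs : |b + c - a| < p := by
      rw [abs_sub_lt_iff]; constructor <;> omega
    have h0 : b + c - a = 0 := Int.eq_zero_of_abs_lt_dvd hdiv habs
    have habc : a = b + c := by omega
    -- parity (Claim 5.7C): neither `a`, `b`, nor `c` is even — absurd since `a = b + c`
    obtain ⟨hae, hbe⟩ := parity_core hodd (by omega) hXY ha hza hb hyb hc habc ha0.ne' hb0.ne'
    obtain ⟨-, hce⟩ := parity_core hodd (by omega) hXY.symm (by rw [← ha]; ring) hza hc hxc hb (by rw [habc]; ring)
      ha0.ne' hc0.ne'
    have hbo : Odd b := Int.not_even_iff_odd.mp hbe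
    have hco : Odd c := Int.not_even_iff_odd.mp hce
    exact hae (habc ▸ hbo.add_odd hco)
  have h1 : ((p : ℤ) + 1) ^ p ≤ a ^ p := pow_le_pow_left₀ (by positivity) hclaim p
  have h2 : ((p : ℤ) + 1) ^ p < 2 * z := by
    have : (y : ℤ) < z := by exact_mod_cast hyz
    have : (x : ℤ) < z := by exact_mod_cast hxz
    linarith
  exact_mod_cast h2

/-- **[ExpEst] Lemma 5.7** (Elementary estimate for possible solutions of the Fermat equation, p. 227): "Let
`p ≥ 3` be a prime number; `x, y, z` coprime positive integers such that `x^p + y^p = z^p`. Then it holds that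
`z > (p + 1)^p/2`." PROVED (as `(p + 1)^p < 2z`; "coprime" rendered as `Nat.Coprime x y`, which for a Fermat triple
is equivalent to the coprimality of all three), following the printed three cases `p ∣ xy` / `p ∤ xyz` / `p ∣ z`
(Claims 5.7A–C); in the case `p ∣ z` the kernel uses the lifting-the-exponent lemma (`v_p(x + y) = p·v_p(z) − 1`)
in place of the printed decomposition of Lemma 5.6 (iii). [cite: MochizukiEtAl2022, Lemma 5.7 p. 227] -/
theorem lemma57 (hp : p.Prime) (hp3 : 3 ≤ p) {x y z : ℕ} (hx : 0 < x) (hy : 0 < y) (hxy : Nat.Coprime x y)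
    (heq : x ^ p + y ^ p = z ^ p) : (p + 1) ^ p < 2 * z := by
  by_cases hpx : p ∣ x
  · exact lemma57_case_dvd_x hp hp3 hx hy hxy heq hpx
  by_cases hpy : p ∣ y
  · exact lemma57_case_dvd_x hp hp3 hy hx hxy.symm (by rw [add_comm]; exact heq) hpy
  by_cases hpz : p ∣ z
  · exact lemma57_case_dvd_z hp hp3 hx hy hxy heq hpz
  · exact lemma57_case_ndvd hp hp3 hx hy hxy heq hpx hpy hpz

end Lemma57

/-! ### Lemma 5.6 (iii), "in particular" — the decomposition Lemma 5.7's printed proof invokes in the case `p ∣ z`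
(appended; Lemma 5.6 (i)–(iii) themselves are in `ExplicitEstimatesFermatLemmas.lean`) -/

section Lemma56iii

variable {p : ℕ}

/-- **[ExpEst] Lemma 5.6 (iii), "in particular"** (p. 226): "In particular, if we write `t = p^κ v`, where
`κ ∈ ℤ_{>0}`, `v ∈ ℤ ∖ pℤ`, then [since `(r + s)·(r^p + s^p)(r + s)⁻¹ = (−t)^p`] there exist integers `w ∉ pℤ` and
`w̃ ∉ pℤ` such that `r + s = p^{κp−1} w^p`; `(r^p + s^p)(r + s)⁻¹ = p w̃^p`; `v = −w w̃` [cf. (i)]." PROVED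
(hypotheses as in `lemma56_iii`, plus the factorisation `t = p^κ v`, `κ > 0`, `p ∤ v`): from (iii)
`Q = p·Q'` with `p ∤ Q'`, so `(r + s)·Q' = p^{κp−1}(−v)^p`, `p^{κp−1} ∣ r + s`, and the cofactors are coprime by
(i) and both `p`-th powers (Mathlib `exists_associated_pow_of_mul_eq_pow`, as in (ii)).
[cite: MochizukiEtAl2022, Lemma 5.6 (iii) p. 226] -/
theorem lemma56_iii_particular (hp : p.Prime) (hodd : Odd p) {r s t : ℤ} (hrs : IsCoprime r s)
    (ht : t ≠ 0) (heq : r ^ p + s ^ p + t ^ p = 0) {k : ℕ} (hk : 0 < k) {v : ℤ}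
    (hv : ¬ (p : ℤ) ∣ v) (htv : t = (p : ℤ) ^ k * v) :
    ∃ w w' : ℤ, ¬ (p : ℤ) ∣ w ∧ ¬ (p : ℤ) ∣ w' ∧ r + s = (p : ℤ) ^ (k * p - 1) * w ^ p ∧
      powSumQuot p r s = p * w' ^ p ∧ v = -(w * w') := by
  have hP : Prime (p : ℤ) := Nat.prime_iff_prime_int.mp hp
  have hp0 : (p : ℤ) ≠ 0 := by exact_mod_cast hp.ne_zero
  have hpt : (p : ℤ) ∣ t := by
    refine ⟨(p : ℤ) ^ (k - 1) * v, ?_⟩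
    rw [htv, ← mul_assoc, ← pow_succ', Nat.sub_add_cancel hk]
  obtain ⟨hA, hQ, hQ2⟩ := lemma56_iii hp hodd hrs ht heq hpt
  have hprod := add_mul_powSumQuot_eq hodd heq
  obtain ⟨Q', hQ'⟩ := hQ
  have hpQ' : ¬ (p : ℤ) ∣ Q' := by
    intro h
    apply hQ2
    rw [hQ', sq]
    exact mul_dvd_mul_left _ h
  -- `(−t)^p = p^{kp} (−v)^p`
  have htp : (-t) ^ p = (p : ℤ) ^ (k * p) * (-v) ^ p := by
    rw [htv, show -((p : ℤ) ^ k * v) = (p : ℤ) ^ k * (-v) by ring, mul_pow, ← pow_mul]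
  have hkp : 1 ≤ k * p := Nat.one_le_iff_ne_zero.mpr (Nat.mul_ne_zero hk.ne' hp.ne_zero)
  -- `(r + s)·Q' = p^{kp−1} (−v)^p`
  have hAQ' : (r + s) * Q' = (p : ℤ) ^ (k * p - 1) * (-v) ^ p := by
    have h1 : (p : ℤ) * ((r + s) * Q') = (p : ℤ) * ((p : ℤ) ^ (k * p - 1) * (-v) ^ p) := by
      calc (p : ℤ) * ((r + s) * Q') = (r + s) * (p * Q') := by ring
        _ = (-t) ^ p := by rw [← hQ', hprod]
        _ = (p : ℤ) ^ (k * p - 1 + 1) * (-v) ^ p := by rw [Nat.sub_add_cancel hkp, htp]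
        _ = (p : ℤ) * ((p : ℤ) ^ (k * p - 1) * (-v) ^ p) := by rw [pow_succ]; ring
    exact mul_left_cancel₀ hp0 h1
  -- `p^{kp−1} ∣ r + s`
  have hcopQ' : IsCoprime ((p : ℤ) ^ (k * p - 1)) Q' :=
    ((Prime.coprime_iff_not_dvd hP).mpr hpQ').pow_left
  obtain ⟨A', hA'⟩ : (p : ℤ) ^ (k * p - 1) ∣ r + s :=
    hcopQ'.dvd_of_dvd_mul_right ⟨(-v) ^ p, hAQ'⟩
  have hA'Q' : A' * Q' = (-v) ^ p := by
    refine mul_left_cancel₀ (pow_ne_zero (k * p - 1) hp0) ?_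
    rw [← mul_assoc, ← hA', hAQ']
  have hpv' : ¬ (p : ℤ) ∣ (-v) ^ p := fun h => hv (dvd_neg.mp (hP.dvd_of_dvd_pow h))
  have hpA' : ¬ (p : ℤ) ∣ A' := fun h => hpv' (hA'Q' ▸ dvd_mul_of_dvd_left h _)
  -- the cofactors are coprime, by (i)
  have hcop : IsCoprime A' Q' := by
    rw [Int.isCoprime_iff_gcd_eq_one]
    by_contra hg
    obtain ⟨l, hl, hlg⟩ := Nat.exists_prime_and_dvd hg
    have hl1' : (l : ℤ) ∣ A' := dvd_trans (Int.natCast_dvd_natCast.mpr hlg) (Int.gcd_dvd_left ..)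
    have hl2' : (l : ℤ) ∣ Q' := dvd_trans (Int.natCast_dvd_natCast.mpr hlg) (Int.gcd_dvd_right ..)
    have hl1 : (l : ℤ) ∣ r + s := hA' ▸ dvd_mul_of_dvd_right hl1' _
    have hl2 : (l : ℤ) ∣ powSumQuot p r s := hQ' ▸ dvd_mul_of_dvd_right hl2' _
    have hlp : l = p := lemma56_i hp hodd hrs hl hl1 hl2
    subst hlp
    exact hpQ' hl2'
  -- both cofactors are `p`-th powers (unique factorisation, as in (ii))
  have hunit : IsUnit (gcd A' Q') := by
    rw [← Int.coe_gcd, Int.isCoprime_iff_gcd_eq_one.mp hcop]; simp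
  have hunit' : IsUnit (gcd Q' A') := by
    rw [gcd_comm]; exact hunit
  obtain ⟨d, hd⟩ := exists_associated_pow_of_mul_eq_pow hunit hA'Q'
  obtain ⟨e, he⟩ := exists_associated_pow_of_mul_eq_pow hunit' (by rw [mul_comm]; exact hA'Q')
  obtain ⟨w, hw⟩ : ∃ w : ℤ, A' = w ^ p := by
    rcases Int.associated_iff.mp hd with h | h
    · exact ⟨d, h.symm⟩
    · exact ⟨-d, by rw [hodd.neg_pow]; linarith⟩
  obtain ⟨w', hw'⟩ : ∃ w' : ℤ, Q' = w' ^ p := by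
    rcases Int.associated_iff.mp he with h | h
    · exact ⟨e, h.symm⟩
    · exact ⟨-e, by rw [hodd.neg_pow]; linarith⟩
  refine ⟨w, w', ?_, ?_, ?_, ?_, ?_⟩
  · exact fun h => hpA' (hw ▸ dvd_pow h hp.ne_zero)
  · exact fun h => hpQ' (hw' ▸ dvd_pow h hp.ne_zero)
  · rw [← hw]; exact hA'
  · rw [← hw']; exact hQ'
  · have h1 : (-v) ^ p = (w * w') ^ p := by rw [mul_pow, ← hw, ← hw', hA'Q']
    have h2 := (hodd.strictMono_pow (R := ℤ)).injective h1
    linarith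

end Lemma56iii

end ExpEst

end Literature.IUT.LogVolume
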